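import Mathlib
import HarnessLib
import Literature.Analysis.PDE.DivFormLiouville
import Summits.NavierStokesRegularity.NavierStokesRegularity.Theorems.PoloidalWindowDoorPoloidalWindowRigidityDivFormCaccioppoli
import Summits.NavierStokesRegularity.NavierStokesRegularity.Theorems.PoloidalWindowDoorPoloidalWindowRigidityDivFormCutoffEnergy

/-!
# Route `PoloidalWindowDoor`, crux K2 (stmt-NavierStokesRegularity-19708) — task H5, step M3a (part 2): the ONE-STEP REVERSE
# HÖLDER inequality on concentric balls for `div(a∇u) = 0` (Moser 1961 (4.6); Gilbarg–Trudinger (8.54)–(8.55))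

Setting = the rendering of the named fact `Literature.Analysis.PDE.divFormLiouville` (`a` measurable, symmetric,
`λ|ξ|² ≤ ξ·aξ`, `|aᵢⱼ| ≤ Λ`; `u ∈ C¹(ℝⁿ)` an entire weak solution with `u ≥ 1`), dimension `n ≥ 3`, `κ = n/(n−2)`.

* `reverseHolder_ball_cutoff` — with a given cutoff between `B(x₀,r) ⊂ B(x₀,R)` and the Gagliardo–Nirenberg–Sobolev
  inequality (Mathlib, `p = 2`, `p* = 2κ`) applied to `χ·u^{p/2}` (energy bound from `…DivFormCutoffEnergy`):
  `(∫⁻_{B(x₀,r)} u^{κp})^{1/κ} ≤ C_S² · 2((p/(p−1))² nΛ/λ + 1)(C₁/(R−r))² · ∫⁻_{B(x₀,R)} u^p`;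
* `exists_reverseHolder_const` — the same with ONE constant `K = K(n, λ, Λ)`:
  `(∫⁻_{B(x₀,r)} u^{κp})^{1/κ} ≤ K (1 + (p/(p−1))²) (R−r)⁻² ∫⁻_{B(x₀,R)} u^p` for all `p ∉ {0,1}`, `0 < r < R`.

This is the step iterated by Moser (the tree's `MoserIteration.eLpNorm_top_le_of_moser_chain`) to bound `sup u` by
`(⨍ u^p)^{1/p}` and `inf u` by `(⨍ u^{−p})^{−1/p}`; seat nsreg-p6 g7, helper of the crux (the fact's claim #1 is K2-p3's).

WHAT THIS IS NOT: not the Harnack inequality and not the Liouville theorem; nothing NS-specific.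
-/

noncomputable section

open MeasureTheory Set Function Filter Topology Metric
open scoped Matrix ENNReal NNReal

-- the summit and its single sub-problem share the name (CONVENTIONS §1), as in every Theorems file
set_option linter.dupNamespace false

namespace Summit.NavierStokesRegularity.NavierStokesRegularity.Theorems.PoloidalWindowDoorPoloidalWindowRigidityDivFormSobolevStep

open Summit.NavierStokesRegularity.NavierStokesRegularity.Theorems.PoloidalWindowDoorPoloidalWindowRigidityDivFormCaccioppoli
open Summit.NavierStokesRegularity.NavierStokesRegularity.Theorems.PoloidalWindowDoorPoloidalWindowRigidityDivFormCutoffEnergy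

variable {n : ℕ}
variable {a : EuclideanSpace ℝ (Fin n) → Matrix (Fin n) (Fin n) ℝ} {lam Λ : ℝ} {u : EuclideanSpace ℝ (Fin n) → ℝ}

/-! ### The reverse Hölder step (Gagliardo–Nirenberg–Sobolev) -/

/-- **One-step reverse Hölder inequality with a given cutoff** (`n ≥ 3`, `κ = n/(n−2)`, `p ∉ {0,1}`):
`(∫⁻_{B(x₀,r)} u^{κp})^{1/κ} ≤ C_S² · 2((p/(p−1))² nΛ/λ + 1)(C₁/(R−r))² · ∫⁻_{B(x₀,R)} u^p`, where `C_S` is Mathlib's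
Gagliardo–Nirenberg–Sobolev constant for `(ℝⁿ, p = 2)`. -/
theorem reverseHolder_ball_cutoff (hn : 3 ≤ n) (hsymm : ∀ y, (a y).IsSymm) (hlam : 0 < lam)
    (hmeas : ∀ i j, Measurable fun y => a y i j)
    (hell : ∀ y (ξ : Fin n → ℝ), lam * (ξ ⬝ᵥ ξ) ≤ ξ ⬝ᵥ (a y *ᵥ ξ)) (hbd : ∀ y i j, |a y i j| ≤ Λ)
    (hu : ContDiff ℝ 1 u) (hu1 : ∀ y, 1 ≤ u y)
    (hweak : ∀ η : EuclideanSpace ℝ (Fin n) → ℝ, ContDiff ℝ 1 η → HasCompactSupport η →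
      ∫ y, ∑ i, ∑ j, a y i j * fderiv ℝ u y (EuclideanSpace.single i 1) *
        fderiv ℝ η y (EuclideanSpace.single j 1) = 0)
    {p : ℝ} (hp0 : p ≠ 0) (hp1 : p ≠ 1) {χ : EuclideanSpace ℝ (Fin n) → ℝ} (hχ : ContDiff ℝ 1 χ)
    (hχc : HasCompactSupport χ) (hχ01 : ∀ x, 0 ≤ χ x ∧ χ x ≤ 1) {x₀ : EuclideanSpace ℝ (Fin n)} {r R C₁ : ℝ}
    (hχ1 : ∀ x ∈ ball x₀ r, χ x = 1) (hχ0 : ∀ x, x ∉ ball x₀ R → χ x = 0)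
    (hχD : ∀ x, ‖fderiv ℝ χ x‖ ≤ C₁ / (R - r)) :
    (∫⁻ y in ball x₀ r, ENNReal.ofReal (u y ^ ((n : ℝ) / ((n : ℝ) - 2) * p))) ^ (((n : ℝ) - 2) / n) ≤
      ENNReal.ofReal ((eLpNormLESNormFDerivOfEqInnerConst (volume : Measure (EuclideanSpace ℝ (Fin n))) 2 : ℝ) ^ 2 *
          (2 * ((p / (p - 1)) ^ 2 * (n * Λ / lam) + 1) * (C₁ / (R - r)) ^ 2)) *
        ∫⁻ y in ball x₀ R, ENNReal.ofReal (u y ^ p) := by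
  have hupos : ∀ y, 0 < u y := fun y => lt_of_lt_of_le one_pos (hu1 y)
  have hupow : ∀ q : ℝ, Continuous fun y => u y ^ q := fun q =>
    hu.continuous.rpow_const fun y => Or.inl (hupos y).ne'
  have hwd : ContDiff ℝ 1 fun y => u y ^ (p / 2) := hu.rpow_const_of_ne fun y => (hupos y).ne'
  have hn0 : (0 : ℝ) < n := by exact_mod_cast (show 0 < n by omega)
  have hn2 : (0 : ℝ) < (n : ℝ) - 2 := by
    have : (3 : ℝ) ≤ n := by exact_mod_cast hn
    linarith
  -- the Sobolev exponent `2κ = 2n/(n-2)`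
  set pS : ℝ≥0 := Real.toNNReal (2 * n / ((n : ℝ) - 2)) with hpS
  have hpS_coe : (pS : ℝ) = 2 * n / ((n : ℝ) - 2) := Real.coe_toNNReal _ (by positivity)
  have hpS_pos : (0 : ℝ) < pS := by rw [hpS_coe]; positivity
  have hpS0 : pS ≠ 0 := by
    intro h; rw [h] at hpS_pos; simp at hpS_pos
  -- the test function `g = χ u^{p/2}`
  set g : EuclideanSpace ℝ (Fin n) → ℝ := fun y => χ y * u y ^ (p / 2) with hg
  have hgd : ContDiff ℝ 1 g := hχ.mul hwd
  have hgc : HasCompactSupport g := hχc.mul_right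
  -- Gagliardo–Nirenberg–Sobolev with `p = 2`
  have hGNS := eLpNorm_le_eLpNorm_fderiv_of_eq_inner (volume : Measure (EuclideanSpace ℝ (Fin n))) hgd hgc
    (p := 2) (p' := pS) (by norm_num) (by rw [finrank_euclideanSpace_fin]; omega)
    (by rw [finrank_euclideanSpace_fin, hpS_coe]; push_cast; field_simp)
  have h2coe : ((2 : ℝ≥0) : ℝ) = 2 := by norm_num
  rw [h2coe] at hGNS
  set CS : ℝ≥0 := eLpNormLESNormFDerivOfEqInnerConst (volume : Measure (EuclideanSpace ℝ (Fin n))) 2 with hCS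
  -- (a) the left-hand side is dominated by `‖g‖_{2κ}^{2κ}`
  have hleft : ∫⁻ y in ball x₀ r, ENNReal.ofReal (u y ^ ((n : ℝ) / ((n : ℝ) - 2) * p)) ≤
      eLpNorm g pS volume ^ (pS : ℝ) := by
    rw [eLpNorm_nnreal_pow_eq_lintegral hpS0]
    calc ∫⁻ y in ball x₀ r, ENNReal.ofReal (u y ^ ((n : ℝ) / ((n : ℝ) - 2) * p))
        = ∫⁻ y in ball x₀ r, ‖g y‖ₑ ^ (pS : ℝ) := by
          refine setLIntegral_congr_fun measurableSet_ball fun y hy => ?_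
          have hgy : g y = u y ^ (p / 2) := by simp only [hg, hχ1 y hy, one_mul]
          rw [hgy, Real.enorm_eq_ofReal (Real.rpow_nonneg (hupos y).le _),
            ENNReal.ofReal_rpow_of_pos (Real.rpow_pos_of_pos (hupos y) _), ← Real.rpow_mul (hupos y).le,
            hpS_coe]
          congr 2
          field_simp
      _ ≤ ∫⁻ y, ‖g y‖ₑ ^ (pS : ℝ) := setLIntegral_le_lintegral _ _
  -- (b) the right-hand side is the Dirichlet energy of `g`
  have hIg : Integrable fun y => ‖fderiv ℝ g y‖ ^ 2 := by
    have hgc2 : HasCompactSupport fun y => ‖fderiv ℝ g y‖ ^ 2 :=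
      (hgc.fderiv (𝕜 := ℝ)).norm.comp_left (g := fun s : ℝ => s ^ 2) (by simp)
    exact (((hgd.continuous_fderiv one_ne_zero).norm).pow 2).integrable_of_hasCompactSupport hgc2
  have hright : eLpNorm (fderiv ℝ g) 2 volume ^ (2 : ℝ) = ENNReal.ofReal (∫ y, ‖fderiv ℝ g y‖ ^ 2) := by
    have h := eLpNorm_nnreal_pow_eq_lintegral (f := fderiv ℝ g)
      (μ := (volume : Measure (EuclideanSpace ℝ (Fin n)))) (p := (2 : ℝ≥0)) two_ne_zero
    rw [ENNReal.coe_ofNat, h2coe] at h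
    rw [h, ofReal_integral_eq_lintegral_ofReal hIg (Eventually.of_forall fun y => sq_nonneg _)]
    refine lintegral_congr fun y => ?_
    rw [← ofReal_norm, ENNReal.ofReal_rpow_of_nonneg (norm_nonneg _) (by norm_num), Real.rpow_two]
  have henergy := integral_sq_fderiv_cutoff_rpow_le hsymm hlam hmeas hell hbd hu hu1 hweak hp0 hp1 hχ hχc hχ01
    (x₀ := x₀) hχ0 hχD
  -- the integral over the large ball as a `lintegral`
  have hIball : IntegrableOn (fun y => u y ^ p) (ball x₀ R) :=
    ((hupow p).continuousOn.integrableOn_compact (isCompact_closedBall x₀ R)).mono_set ball_subset_closedBall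
  have hball : ENNReal.ofReal (∫ y in ball x₀ R, u y ^ p) = ∫⁻ y in ball x₀ R, ENNReal.ofReal (u y ^ p) :=
    ofReal_integral_eq_lintegral_ofReal hIball (Eventually.of_forall fun y => Real.rpow_nonneg (hupos y).le _)
  -- (c) assemble
  have hexp : (pS : ℝ) * (((n : ℝ) - 2) / n) = 2 := by
    rw [hpS_coe]; field_simp
  have hK0 : 0 ≤ 2 * ((p / (p - 1)) ^ 2 * (n * Λ / lam) + 1) * (C₁ / (R - r)) ^ 2 := by
    have hΛ0 : 0 ≤ n * Λ :=
      mul_nonneg (Nat.cast_nonneg _) ((abs_nonneg _).trans (hbd 0 ⟨0, by omega⟩ ⟨0, by omega⟩))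
    positivity
  have hCS2 : ((CS : ℝ≥0) : ℝ≥0∞) ^ 2 = ENNReal.ofReal ((CS : ℝ) ^ 2) := by
    rw [ENNReal.ofReal_pow (NNReal.coe_nonneg _), ENNReal.ofReal_coe_nnreal]
  calc (∫⁻ y in ball x₀ r, ENNReal.ofReal (u y ^ ((n : ℝ) / ((n : ℝ) - 2) * p))) ^ (((n : ℝ) - 2) / n)
      ≤ (eLpNorm g pS volume ^ (pS : ℝ)) ^ (((n : ℝ) - 2) / n) := ENNReal.rpow_le_rpow hleft (by positivity)
    _ ≤ (((CS : ℝ≥0∞) * eLpNorm (fderiv ℝ g) 2 volume) ^ (pS : ℝ)) ^ (((n : ℝ) - 2) / n) :=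
        ENNReal.rpow_le_rpow (ENNReal.rpow_le_rpow hGNS hpS_pos.le) (by positivity)
    _ = ((CS : ℝ≥0∞) * eLpNorm (fderiv ℝ g) 2 volume) ^ (2 : ℝ) := by
        rw [← ENNReal.rpow_mul, hexp]
    _ = (CS : ℝ≥0∞) ^ 2 * ENNReal.ofReal (∫ y, ‖fderiv ℝ g y‖ ^ 2) := by
        rw [ENNReal.mul_rpow_of_nonneg _ _ (by norm_num), hright, ENNReal.rpow_two]
    _ ≤ (CS : ℝ≥0∞) ^ 2 * ENNReal.ofReal (2 * ((p / (p - 1)) ^ 2 * (n * Λ / lam) + 1) * (C₁ / (R - r)) ^ 2 *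
          ∫ y in ball x₀ R, u y ^ p) := by
        gcongr
    _ = ENNReal.ofReal ((CS : ℝ) ^ 2 * (2 * ((p / (p - 1)) ^ 2 * (n * Λ / lam) + 1) * (C₁ / (R - r)) ^ 2)) *
          ∫⁻ y in ball x₀ R, ENNReal.ofReal (u y ^ p) := by
        rw [hCS2, ← hball, ← ENNReal.ofReal_mul (sq_nonneg _), ← ENNReal.ofReal_mul (mul_nonneg (sq_nonneg _) hK0)]
        congr 1
        ring

/-- **The reverse Hölder step, with a constant depending only on `(n, λ, Λ)`** (Moser 1961 (4.6);
Gilbarg–Trudinger (8.54)): for `n ≥ 3`, `κ = n/(n−2)`, there is `K ≥ 0` such that for every admissible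
coefficient field, every entire `C¹` weak solution `u ≥ 1`, every `p ∉ {0,1}` and all balls `B(x₀,r) ⊂ B(x₀,R)`:
`(∫⁻_{B(x₀,r)} u^{κp})^{1/κ} ≤ K (1 + (p/(p−1))²) (R−r)⁻² ∫⁻_{B(x₀,R)} u^p`. -/
theorem exists_reverseHolder_const (hn : 3 ≤ n) {lam Λ : ℝ} (hlam : 0 < lam) :
    ∃ K : ℝ, 0 ≤ K ∧ ∀ (a : EuclideanSpace ℝ (Fin n) → Matrix (Fin n) (Fin n) ℝ),
      (∀ i j, Measurable fun y => a y i j) → (∀ y, (a y).IsSymm) →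
      (∀ y (ξ : Fin n → ℝ), lam * (ξ ⬝ᵥ ξ) ≤ ξ ⬝ᵥ (a y *ᵥ ξ)) → (∀ y i j, |a y i j| ≤ Λ) →
      ∀ (u : EuclideanSpace ℝ (Fin n) → ℝ), ContDiff ℝ 1 u → (∀ y, 1 ≤ u y) →
        (∀ η : EuclideanSpace ℝ (Fin n) → ℝ, ContDiff ℝ 1 η → HasCompactSupport η →
          ∫ y, ∑ i, ∑ j, a y i j * fderiv ℝ u y (EuclideanSpace.single i 1) *
            fderiv ℝ η y (EuclideanSpace.single j 1) = 0) →
        ∀ (p : ℝ), p ≠ 0 → p ≠ 1 → ∀ (x₀ : EuclideanSpace ℝ (Fin n)) (r R : ℝ), 0 < r → r < R →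
          (∫⁻ y in ball x₀ r, ENNReal.ofReal (u y ^ ((n : ℝ) / ((n : ℝ) - 2) * p))) ^ (((n : ℝ) - 2) / n) ≤
            ENNReal.ofReal (K * (1 + (p / (p - 1)) ^ 2) / (R - r) ^ 2) *
              ∫⁻ y in ball x₀ R, ENNReal.ofReal (u y ^ p) := by
  obtain ⟨C₁, hC₁, hcut⟩ := exists_cutoff_two_radii n
  set CS : ℝ := (eLpNormLESNormFDerivOfEqInnerConst (volume : Measure (EuclideanSpace ℝ (Fin n))) 2 : ℝ) with hCS
  have hCS0 : 0 ≤ CS := NNReal.coe_nonneg _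
  refine ⟨CS ^ 2 * 2 * C₁ ^ 2 * (1 + n * |Λ| / lam), by positivity, ?_⟩
  intro a hmeas hsymm hell hbd u hu hu1 hweak p hp0 hp1 x₀ r R hr hrR
  obtain ⟨χ, hχ, hχc, hχ01, hχ1, hχ0, hχD⟩ := hcut x₀ r R hr hrR
  refine (reverseHolder_ball_cutoff hn hsymm hlam hmeas hell hbd hu hu1 hweak hp0 hp1 hχ hχc hχ01 hχ1 hχ0
    hχD).trans ?_
  refine mul_le_mul_left (ENNReal.ofReal_le_ofReal ?_) _
  have hRr : 0 < R - r := sub_pos.2 hrR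
  rw [← hCS, le_div_iff₀ (pow_pos hRr 2)]
  set X : ℝ := (p / (p - 1)) ^ 2 with hX
  have hΛ : Λ ≤ |Λ| := le_abs_self Λ
  have h3 : 0 ≤ X := sq_nonneg _
  have h1 : X * (n * Λ / lam) ≤ X * (n * |Λ| / lam) := by gcongr
  have h2 : 0 ≤ n * |Λ| / lam := by positivity
  have hc : (C₁ / (R - r)) ^ 2 * (R - r) ^ 2 = C₁ ^ 2 := by
    rw [div_pow, div_mul_cancel₀ _ (pow_ne_zero 2 hRr.ne')]
  calc CS ^ 2 * (2 * (X * (n * Λ / lam) + 1) * (C₁ / (R - r)) ^ 2) * (R - r) ^ 2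
      = CS ^ 2 * 2 * (X * (n * Λ / lam) + 1) * ((C₁ / (R - r)) ^ 2 * (R - r) ^ 2) := by ring
    _ = CS ^ 2 * 2 * C₁ ^ 2 * (X * (n * Λ / lam) + 1) := by rw [hc]; ring
    _ ≤ CS ^ 2 * 2 * C₁ ^ 2 * ((1 + n * |Λ| / lam) * (1 + X)) := by
        apply mul_le_mul_of_nonneg_left _ (by positivity)
        nlinarith [mul_nonneg h2 h3]
    _ = CS ^ 2 * 2 * C₁ ^ 2 * (1 + n * |Λ| / lam) * (1 + X) := by ring

end Summit.NavierStokesRegularity.NavierStokesRegularity.Theorems.PoloidalWindowDoorPoloidalWindowRigidityDivFormSobolevStep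

end
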